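import Mathlib.SetTheory.Cardinal.Finite
import Literature.IUT.HodgeTheaters.TemperedCoveringsProTree
import Literature.AnabelianGeometry.SemiGraphs.TemperedGroupsLimit
import Literature.AnabelianGeometry.SemiGraphs.TemperedMaximalCompact
import HarnessLib

/-!
# [IUTchI] Prop. 2.1 / Prop. 2.2 on a tempered fundamental group CHART: the [SemiAnbd] inputs BY NAME

Mochizuki, *Inter-universal Teichmüller theory I*, kurims manuscript (May 2020), §2, Proposition
2.1 "Profinite Conjugates of Nontrivial Compact Subgroups" and Proposition 2.2, p. 45
[cite: Mochizuki2012, Prop 2.1 p.45] (D-0012 claim key; series status DISPUTED; nothing of the series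
is asserted here).  PROOF-ONLY continuation of `TemperedCoveringsProTree.lean` (abc-iut-L5-t11): there,
abc-iut-L5-t1's predicate `TemperedGraphGroupData.ProfiniteConjugatesOfCompactSubgroups D`
([IUTchI] Prop. 2.1 AS TYPED, `TemperedCoverings.lean` p405450) was derived from the inputs of the
printed proof stated as HYPOTHESES in the data's own vocabulary — (A1) "[SemiAnbd] Thm 3.7 (iii)",
a chosen verticial subgroup per vertex, an infinite compact verticial subgroup, temperedness and
Hausdorffness of `Π^tp_𝔾`.  Here these inputs are DISCHARGED BY NAME from abc-iut-L3's typed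
[SemiAnbd] §3 interface, for any data `D` whose tempered part `Π^tp_𝔾 = D.Tp` is identified
(`e : D.Tp ≃ₜ* c.G`) with a tempered fundamental group chart `c : TemperedPiChart 𝒢` of a semi-graph
of anabelioids `𝒢` satisfying the hypotheses of [SemiAnbd] Thm. 3.7:

* (A1) ⇐ the named fact `ProfiniteSemiGraph.CompactInVerticial` ([SemiAnbd] Thm 3.7 (iii)) + "the
  verticial subgroups at `v` form one conjugacy class" (`exists_conj_of_mem_verticialSubgroups`,
  abc-iut-L3-t11) — `TemperedGraphGroupData.conj_le_of_compactInVerticial`;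
* a verticial subgroup at every vertex ⇐ `ProfiniteSemiGraph.VerticialInjective` ([SemiAnbd] Thm 3.7
  (i)) — `exists_verticial_family_of_chart`;
* "any verticial [hence, in particular, nontrivial compact!] subgroup" is compact AND infinite ⇐
  `isCompact_of_mem_verticialSubgroups` + "totally elevated" (Def. 2.4 (i), a field of
  `Thm37Hypotheses`) + `VerticialInjective` — `ProfiniteSemiGraph.infinite_vertexGroup_of_isElevatedVertex`,
  `ProfiniteSemiGraph.infinite_of_mem_verticialSubgroups`;
* `Π^tp_𝔾` tempered ([SemiAnbd] Prop 3.6 (i)) ⇐ the chart field `TemperedPiChart.isTempered` —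
  `TemperedGraphGroupData.isTempered_tp_of_chart`.

Main declarations: `TemperedGraphGroupData.prop21_of_chart` (Prop. 2.1 for `D`) and
`TemperedGraphGroupData.tp_isCommensurablyTerminal_of_chart` (Prop. 2.2, "in particular, `Π^tp_𝔾`
is commensurably terminal in `Π̂_𝔾`").  What REMAINS hypothesis (and why): (RF)/Hausdorffness on the
pro-`Σ̂` side `Π̂_𝔾 = D.Hat` (the data's completion is abstract; for `Σ̂ = 𝔓𝔯𝔦𝔪𝔢𝔰` see
`closedBasis_of_residuallyFinite_quotients`), and (A3) = [NodNon] Lem 1.9 (ii) / [AbsTopII] Prop 1.3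
(iv) "for appropriate choices of conjugates" at the level of the universal pro-covering `Γ̂`, in coset
coordinates with branch conjugators `c₁ c₂` — no typed name of that strength exists in the tree (the
[AbsTopII] file's `DPSCData.Prop13iv` records the base-vertex trichotomy only).  Not a discharge of
the node IUTchI:Prop2.1; typed ≠ discharged; nothing here bears on [IUTchIII] Cor. 3.12.
-/

namespace Literature.IUT.HodgeTheaters

open Pointwise Filter
open _root_.Topology
open Literature.AnabelianGeometry.SemiGraphs (IsTempered ProfiniteSemiGraph)
open Literature.AnabelianGeometry.SemiGraphs.ProfiniteSemiGraph (TemperedPiChart verticialSubgroups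
  CompactInVerticial VerticialInjective IsVerticialHom isCompact_of_mem_verticialSubgroups
  exists_conj_of_mem_verticialSubgroups)
open Literature.AnabelianGeometry.AbsoluteAnabelian (IsCommensurablyTerminal)

universe u

/-! ### Two [SemiAnbd] §2–§3 consequences in the chart's own vocabulary -/

/-- An *elevated* vertex ([SemiAnbd] Def. 2.4 (i) p. 25) has INFINITE vertex group `Π_v`: for every
`M` some `π₁`-epimorphic approximator has a subgroup of order `≥ M` in the finite quotient `F_v` of
`Π_v`. [cite: MochizukiSemiAnbd2006, Def 2.4(i) p.25] -/
theorem _root_.Literature.AnabelianGeometry.SemiGraphs.ProfiniteSemiGraph.infinite_vertexGroup_of_isElevatedVertex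
    {𝒢 : ProfiniteSemiGraph.{u}} {v : 𝒢.graph.Vertex} (hv : 𝒢.IsElevatedVertex v) :
    Infinite (𝒢.Gv v) := by
  by_contra hfin
  rw [not_infinite_iff_finite] at hfin
  obtain ⟨A, hA, N, hMN, -⟩ := hv (Nat.card (𝒢.Gv v) + 1)
  have h1 : Nat.card N ≤ Nat.card (A.FV v) :=
    Nat.card_le_card_of_injective N.subtype N.subtype_injective
  have h2 : Nat.card (A.FV v) ≤ Nat.card (𝒢.Gv v) :=
    Nat.card_le_card_of_surjective _ (hA.1 v)
  omega

/-- Under the hypotheses of [SemiAnbd] Thm. 3.7 (in particular "totally elevated") and Thm. 3.7 (i)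
(`VerticialInjective`: the verticial homomorphisms `Π_v ↪ π₁^temp(G)` are injective), every verticial
subgroup of `π₁^temp(G)` is INFINITE ("any verticial [hence, in particular, nontrivial compact!]
subgroup", [IUTchI] p. 45). [cite: MochizukiSemiAnbd2006, Thm 3.7(i) p.40] -/
theorem _root_.Literature.AnabelianGeometry.SemiGraphs.ProfiniteSemiGraph.infinite_of_mem_verticialSubgroups
    {𝒢 : ProfiniteSemiGraph.{u}} (h𝒢 : 𝒢.Thm37Hypotheses) (hVI : VerticialInjective.{u})
    (c : TemperedPiChart 𝒢) {v : 𝒢.graph.Vertex} {H : Subgroup c.G}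
    (hH : H ∈ verticialSubgroups c v) : (H : Set c.G).Infinite := by
  obtain ⟨φ, ⟨i⟩, rfl⟩ := hH
  haveI := ProfiniteSemiGraph.infinite_vertexGroup_of_isElevatedVertex (h𝒢.isTotallyElevated v)
  rw [MonoidHom.coe_range]
  exact Set.infinite_range_of_injective ((hVI 𝒢 h𝒢 c v).2 φ ⟨i⟩)

namespace TemperedGraphGroupData

variable (D : TemperedGraphGroupData.{u}) {𝒢 : ProfiniteSemiGraph.{u}}

/-- `Π^tp_𝔾` is tempered ([SemiAnbd] Prop 3.6 (i), the chart field `isTempered`), transported to the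
data `D` along the identification `e : Π^tp_𝔾 ≃ π₁^temp(𝒢)`. [cite: Mochizuki2012, §2 p.44] -/
theorem isTempered_tp_of_chart (c : TemperedPiChart 𝒢) (e : D.Tp ≃ₜ* c.G) : IsTempered D.Tp := by
  obtain ⟨S, ⟨e'⟩⟩ := c.isTempered.limitPresentation
  exact IsTempered.of_limitPresentation S (e.trans e')

/-- [SemiAnbd] Thm 3.7 (i) (`VerticialInjective`, first clause: verticial subgroups exist at every
vertex) supplies a verticial subgroup `Λ_v ⊆ Π^tp_𝔾` for every vertex `v` of `𝔾` — the choice the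
coset coordinates of `prop21_of_cosetTree` are built on. [cite: MochizukiSemiAnbd2006, Thm 3.7(i) p.40] -/
theorem exists_verticial_family_of_chart (c : TemperedPiChart 𝒢) (e : D.Tp ≃ₜ* c.G)
    (h𝒢 : 𝒢.Thm37Hypotheses) (hVI : VerticialInjective.{u}) :
    ∃ Λv : 𝒢.graph.Vertex → Subgroup D.Tp,
      ∀ v, (Λv v).map (e : D.Tp →* c.G) ∈ verticialSubgroups c v := by
  refine ⟨fun v => ((hVI 𝒢 h𝒢 c v).1.some).comap (e : D.Tp →* c.G), fun v => ?_⟩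
  rw [Subgroup.map_comap_eq_self_of_surjective (by exact e.surjective)]
  exact (hVI 𝒢 h𝒢 c v).1.some_mem

/-- **(A1) BY NAME.**  [SemiAnbd] Thm 3.7 (iii) (`CompactInVerticial`: "every compact subgroup of
`π₁^temp(G)` is contained in at least one verticial subgroup") together with "the verticial subgroups
at `v` are the conjugates of any one of them" (Prop 3.2, `exists_conj_of_mem_verticialSubgroups`) give
the hypothesis (A1) of `prop21_of_cosetTree`: every nontrivial compact `Λ ⊆ Π^tp_𝔾` lies in
`t·Λ_v·t⁻¹` for some vertex `v` and `t ∈ Π^tp_𝔾` ([IUTchI] p. 45: "it follows from [SemiAnbd] Thm 3.7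
(iii) that `Λ`, `γ·Λ·γ⁻¹` are contained in verticial subgroups").
[cite: Mochizuki2012, Prop 2.1 p.45] -/
theorem conj_le_of_compactInVerticial (c : TemperedPiChart 𝒢) (e : D.Tp ≃ₜ* c.G)
    (h𝒢 : 𝒢.Thm37Hypotheses) (hCV : CompactInVerticial.{u})
    (Λv : 𝒢.graph.Vertex → Subgroup D.Tp)
    (hΛv : ∀ v, (Λv v).map (e : D.Tp →* c.G) ∈ verticialSubgroups c v)
    (Λ : Subgroup D.Tp) (hΛc : IsCompact (Λ : Set D.Tp)) :
    ∃ (v : 𝒢.graph.Vertex) (t : D.Tp), Λ ≤ MulAut.conj t • Λv v := by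
  have hc' : IsCompact ((Λ.map (e : D.Tp →* c.G) : Subgroup c.G) : Set c.G) := by
    rw [Subgroup.coe_map]
    exact hΛc.image e.continuous
  obtain ⟨⟨v, H, hH, hle⟩, -⟩ := hCV 𝒢 h𝒢 c _ hc'
  obtain ⟨g, hg⟩ := exists_conj_of_mem_verticialSubgroups c (hΛv v) hH
  refine ⟨v, e.symm g, fun l hl => ?_⟩
  have hl' : (e : D.Tp →* c.G) l ∈ H := hle (Subgroup.mem_map_of_mem _ hl)
  rw [hg, Subgroup.mem_map] at hl'
  obtain ⟨y, hy, hyl⟩ := hl'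
  obtain ⟨m, hm, rfl⟩ := Subgroup.mem_map.mp hy
  refine (Subgroup.mem_smul_pointwise_iff_exists l (MulAut.conj (e.symm g)) (Λv v)).mpr
    ⟨m, hm, e.injective ?_⟩
  simp only [MulEquiv.coe_toMonoidHom, MulAut.conj_apply, MonoidHom.coe_coe] at hyl
  rw [MulAut.smul_def, MulAut.conj_apply, map_mul, map_mul, map_inv, ← hyl]
  simp

/-- A verticial subgroup `Λ_{v₀} ⊆ Π^tp_𝔾` is compact and infinite — "any verticial [hence, in
particular, nontrivial compact!] subgroup of `Π^tp_𝔾`" ([IUTchI] p. 45) — BY NAME from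
`isCompact_of_mem_verticialSubgroups` and `infinite_of_mem_verticialSubgroups`; and [SemiAnbd] Thm 3.7's
standing hypothesis "`G` has at least one vertex" supplies `v₀`. [cite: Mochizuki2012, Prop 2.2 p.45] -/
theorem exists_infinite_compact_of_chart (c : TemperedPiChart 𝒢) (e : D.Tp ≃ₜ* c.G)
    (h𝒢 : 𝒢.Thm37Hypotheses) (hVI : VerticialInjective.{u})
    (Λv : 𝒢.graph.Vertex → Subgroup D.Tp)
    (hΛv : ∀ v, (Λv v).map (e : D.Tp →* c.G) ∈ verticialSubgroups c v) :
    ∃ v₀ : 𝒢.graph.Vertex, IsCompact ((Λv v₀ : Subgroup D.Tp) : Set D.Tp) ∧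
      ((Λv v₀ : Subgroup D.Tp) : Set D.Tp).Infinite := by
  obtain ⟨v₀⟩ := h𝒢.hasVertex
  have himg : (e : D.Tp → c.G) '' (Λv v₀ : Set D.Tp) = (Λv v₀).map (e : D.Tp →* c.G) := by
    rw [Subgroup.coe_map, MonoidHom.coe_coe]
  refine ⟨v₀, ?_, ?_⟩
  · rw [← e.toHomeomorph.isCompact_image]
    change IsCompact ((e : D.Tp → c.G) '' _)
    rw [himg]
    exact isCompact_of_mem_verticialSubgroups c (hΛv v₀)
  · refine Set.Infinite.of_image (e : D.Tp → c.G) ?_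
    rw [himg]
    exact ProfiniteSemiGraph.infinite_of_mem_verticialSubgroups h𝒢 hVI c (hΛv v₀)

/-- **[IUTchI] Proposition 2.1 for `D` with `Π^tp_𝔾` a tempered fundamental group chart of `𝒢`**, the
[SemiAnbd] inputs BY NAME: (A0) from temperedness (`TemperedPiChart.isTempered`, via abc-iut-L5-t11's
`IsTempered.isCompact_comap` under (RF)), (A1) from `CompactInVerticial` (Thm 3.7 (iii)) for the chosen
verticial family `Λv`.  Remaining hypotheses: Hausdorffness of `Π̂_𝔾` and (RF) on the completion side,
the node data `src tgt c₁ c₂` of the universal pro-covering in coset coordinates, and (A3) = [NodNon]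
Lem 1.9 (ii) / [AbsTopII] Prop 1.3 (iv) ("appropriate conjugates" form) — see
`prop21_of_cosetTree`. ([IUTchI] Prop 2.1 p.45) [claim: Mochizuki2012, status: disputed] -/
theorem prop21_of_chart [T2Space D.Hat] (c : TemperedPiChart 𝒢) (e : D.Tp ≃ₜ* c.G)
    (h𝒢 : 𝒢.Thm37Hypotheses) (hCV : CompactInVerticial.{u})
    (Λv : 𝒢.graph.Vertex → Subgroup D.Tp)
    (hΛv : ∀ v, (Λv v).map (e : D.Tp →* c.G) ∈ verticialSubgroups c v)
    (hRF : ∀ U ∈ 𝓝 (1 : D.Tp), ∃ N : OpenNormalSubgroup D.Tp, (N : Set D.Tp) ⊆ U ∧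
      ((N.toSubgroup.map D.ι).topologicalClosure).comap D.ι ≤ N.toSubgroup)
    {E : Type*} (src tgt : E → 𝒢.graph.Vertex) (c₁ c₂ : E → D.Tp)
    (hA3 : ∀ (v w : 𝒢.graph.Vertex) (g h : D.Hat),
      MulAut.conj g • (Λv v).map D.ι ⊓ MulAut.conj h • (Λv w).map D.ι ≠ ⊥ →
        (v = w ∧ g⁻¹ * h ∈ (Λv v).map D.ι) ∨
        ∃ (e : E) (k : D.Hat), ∃ p ∈ (Λv (src e)).map D.ι, ∃ q ∈ (Λv (tgt e)).map D.ι,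
          (src e = v ∧ tgt e = w ∧ g = k * D.ι (c₁ e) * p ∧ h = k * D.ι (c₂ e) * q) ∨
          (src e = w ∧ tgt e = v ∧ h = k * D.ι (c₁ e) * p ∧ g = k * D.ι (c₂ e) * q)) :
    D.ProfiniteConjugatesOfCompactSubgroups :=
  D.prop21_of_cosetTree_of_isTempered (D.isTempered_tp_of_chart c e) hRF Λv src tgt c₁ c₂
    (fun Λ hΛc _ => D.conj_le_of_compactInVerticial c e h𝒢 hCV Λv hΛv Λ hΛc) hA3

/-- **[IUTchI] Proposition 2.2, "in particular, `Π^tp_𝔾` is commensurably terminal in `Π̂_𝔾`"**, for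
`D` with `Π^tp_𝔾` a tempered fundamental group chart of `𝒢`, the [SemiAnbd] inputs BY NAME: as in
`prop21_of_chart`, plus the infinite compact verticial subgroup the printed proof lets `Λ` range over
("the open subgroups of any verticial [hence, in particular, nontrivial compact!] subgroup of
`Π^tp_𝔾`", p. 45) from `VerticialInjective` + "totally elevated" + "has a vertex".  Remaining
hypotheses exactly as in `prop21_of_chart`. ([IUTchI] Prop 2.2 p.45) [claim: Mochizuki2012, status: disputed] -/
theorem tp_isCommensurablyTerminal_of_chart [T2Space D.Hat] (c : TemperedPiChart 𝒢)
    (e : D.Tp ≃ₜ* c.G) (h𝒢 : 𝒢.Thm37Hypotheses)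
    (hCV : CompactInVerticial.{u}) (hVI : VerticialInjective.{u})
    (Λv : 𝒢.graph.Vertex → Subgroup D.Tp)
    (hΛv : ∀ v, (Λv v).map (e : D.Tp →* c.G) ∈ verticialSubgroups c v)
    (hRF : ∀ U ∈ 𝓝 (1 : D.Tp), ∃ N : OpenNormalSubgroup D.Tp, (N : Set D.Tp) ⊆ U ∧
      ((N.toSubgroup.map D.ι).topologicalClosure).comap D.ι ≤ N.toSubgroup)
    {E : Type*} (src tgt : E → 𝒢.graph.Vertex) (c₁ c₂ : E → D.Tp)
    (hA3 : ∀ (v w : 𝒢.graph.Vertex) (g h : D.Hat),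
      MulAut.conj g • (Λv v).map D.ι ⊓ MulAut.conj h • (Λv w).map D.ι ≠ ⊥ →
        (v = w ∧ g⁻¹ * h ∈ (Λv v).map D.ι) ∨
        ∃ (e : E) (k : D.Hat), ∃ p ∈ (Λv (src e)).map D.ι, ∃ q ∈ (Λv (tgt e)).map D.ι,
          (src e = v ∧ tgt e = w ∧ g = k * D.ι (c₁ e) * p ∧ h = k * D.ι (c₂ e) * q) ∨
          (src e = w ∧ tgt e = v ∧ h = k * D.ι (c₁ e) * p ∧ g = k * D.ι (c₂ e) * q)) :
    IsCommensurablyTerminal D.ι.range := by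
  obtain ⟨v₀, hv₀c, hv₀inf⟩ := D.exists_infinite_compact_of_chart c e h𝒢 hVI Λv hΛv
  exact D.tp_isCommensurablyTerminal_of_cosetTree (D.isTempered_tp_of_chart c e) hRF Λv src tgt
    c₁ c₂ (fun Λ hΛc _ => D.conj_le_of_compactInVerticial c e h𝒢 hCV Λv hΛv Λ hΛc) hA3 v₀ hv₀c
    hv₀inf

end TemperedGraphGroupData

end Literature.IUT.HodgeTheaters
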